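import Summits.CriticalPhenomena.PercolationContinuityZ3.Theses.PercDiodeSteering

/-!
# Birth skeleton (BC3) for the crux `UniformSteering` (stmt-CriticalPhenomena-7551)

Route `route-CriticalPhenomena-PercDiodeSteering` (sub-problem `PercolationContinuityZ3`), crux decl
`Summit.CriticalPhenomena.PercolationContinuityZ3.Theses.PercDiodeSteering.UniformSteering` (rank 5):
with `θ⁺(p, r)` the forward-percolation probability of the resistor–diode network on `ℤ³`
(forward steps passable iff `U ≤ p`, backward steps iff `U ≤ p·r`) and `p_c(r) := inf {q | θ⁺(q, r) > 0}`
its directed-side critical point,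

  `U :≡ ∀ ε > 0, ∃ δ > 0, ∃ r₀ < 1, ∀ r ∈ [r₀, 1), ∀ p ∈ [p_c(r), p_c(r) + δ], θ⁺(p, r) ≤ θ⁺(p_c(r), r) + ε`

— a modulus of right-continuity of `θ⁺(·, r)` at its critical point, measured from the critical VALUE,
uniform as `r ↑ 1` (the route header calls it "the conjunct's residue").

THE LINE (semicontinuity split at the isotropic corner `(p_c, 1)` of Redner's diagram). Continuity of a
monotone family at a moving base point is the conjunction of two one-sided statements; exactly one of
them is free. Writing `θ⁺ = thetaRD`, `p_c(r) = pcRD r`, `p_c = p_c(ℤ³) = pc3`: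

* STUB 1 `stub_endpointUSC` (M, TRUE — provable now modulo the route's two support items): **upper
  semicontinuity of `θ⁺` at the corner, from the upper right** —
  `∀ ε > 0, ∃ δ > 0, ∃ r₀ < 1, ∀ r ∈ [r₀, 1], ∀ p ∈ [p_c, p_c + δ], θ⁺(p, r) ≤ θ⁺(p_c, 1) + ε`.
  Two proofs: (a) `θ⁺(p, r) ≤ θ⁺(p, 1) = θ(p)` (monotone coupling `RDMonotone`, endpoint `RDEndpoint`)
  and right-continuity of `θ` at `p_c` (`θ` = decreasing limit of the box-crossing polynomials
  `P_p(0 ↔ ∂B(n))`, `theta_le_real_siteToBoundary` / `le_theta_of_forall_le_real_siteToBoundary`);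
  (b) intrinsically, `θ⁺ = inf_n P(0 →⁺ ∂B(n))`, an infimum of functions continuous in `(p, r)`.
* STUB 2 `stub_criticalCurveSqueeze` (M, TRUE — provable now modulo the same support items): **the
  critical curve enters the corner** — `∀ r ∈ (0, 1), p_c ≤ p_c(r) ≤ p_c / r` (the trivial
  Aizenman–Grimmett gap bound `γ(r) = p_c/r − p_c(r) ≤ p_c (1 − r)/r`, route header NUMBERS:
  `|a_c(b) − p_c| ≤ b`). Lower bound: `θ⁺(q, r) ≤ θ⁺(max q 0, 1) = θ = 0` for `q < p_c`
  (`theta_eq_zero_of_lt_criticalProb_holds`, as inside the route's `closes`); upper bound: for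
  `q > p_c / r`, `θ⁺(q, r) ≥ θ⁺(q r, 1) = θ(q r) > 0` (resistors alone percolate), and the set
  `{q | θ⁺(q, r) > 0}` is non-empty (it contains every `q ≥ 1`) and bounded below by `p_c`.
* STUB 3 `stub_endpointNoDrop` (OPEN — LOAD-BEARING, the residue in its minimal form): **no drop of the
  critical density at the corner = lower semicontinuity of `r ↦ θ⁺(p_c(r), r)` at `r = 1`** —
  `∀ ε > 0, ∃ r₀ < 1, ∀ r ∈ [r₀, 1), θ⁺(p_c, 1) ≤ θ⁺(p_c(r), r) + ε`, i.e.
  `liminf_{r ↑ 1} θ⁺(p_c(r), r) ≥ θ⁺(p_c, 1) = θ(p_c)`. This is where the whole difficulty of `U`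
  lives: `U`'s three-parameter modulus (`ε, δ, r₀`, a window of `p` above a moving critical point)
  collapses to a ONE-parameter statement along the critical curve. Honest piece: it is implied by the
  crux (`endpointNoDrop_of_uniformSteering` below, using `RDMonotone` + STUB 2), hence by the conjunct
  (`θ(p_c) = 0 ≤ θ⁺ + ε`); given `BackboneSteering` + `DiodeEnhancement` (`θ⁺(p_c(r), r) = 0` for
  `r < 1`) it reads `θ(p_c) ≤ ε`, i.e. it is refutable exactly by `θ(p_c) > 0` — the same kill
  criterion the route records for `U`. Its constructive content on the directed side is the route's
  "how fast does the admissible block scale `L(β)` blow up as the steering budget `β = p_c − r·p_c(r) → 0`":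
  a same-parameter finite-size criterion that is an OPEN condition in `(p, r)` jointly and SHARP
  (characterises `θ⁺ > η`) makes `θ⁺` a supremum of continuous functions near the curve, hence LSC.

Composition (kernel-checked, no `sorry`): `UniformSteering_of : stub_endpointUSC → stub_criticalCurveSqueeze →
stub_endpointNoDrop → UniformSteering` (hypotheses typed by the name-keyed aliases `__Registered.stub_*`):
given `ε`, take `δ₁, r₁` from STUB 1 at `ε/2` and `r₂` from STUB 3 at `ε/2`; answer with `δ := δ₁/2` and
`r₀ := max r₁ r₂ (1/2) (1 − δ₁/4)`. For `r ∈ [r₀, 1)` and `p ∈ [p_c(r), p_c(r) + δ₁/2]`, STUB 2 gives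
`p_c ≤ p ≤ p_c/r + δ₁/2 ≤ p_c + δ₁` (as `p_c (1 − r)/r ≤ 2 (1 − r) ≤ δ₁/2`), so
`θ⁺(p, r) ≤ θ⁺(p_c, 1) + ε/2 ≤ θ⁺(p_c(r), r) + ε`.

DISPROOF USED: none exists for this crux (`ledger crux ls stmt-CriticalPhenomena-7551`: no workfiles, no
`Disproof.lean`, no landed Negative lemma, 2026-08-17). Negatives index of the summit: no statement on
partially oriented / resistor–diode models. Degenerate instances checked: `r ≤ 0` never occurs (every stub
and the glue work with `r ≥ r₀` chosen `≥ 1/2`, STUB 2 assumes `0 < r`); `p < 0` never occurs in STUB 1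
(`p ≥ p_c ≥ 0`); `pcRD r` is junk-free for `r ∈ (0, 1]` (set non-empty and bounded below — refuter note
on the item, re-proved inside the route's `closes`).
-/

noncomputable section

namespace Summit.CriticalPhenomena.PercolationContinuityZ3.Cruxes.UniformSteering.Birth

open MeasureTheory Filter Literature.Probability.Percolation Literature.Probability.LatticeModels
open Summit.CriticalPhenomena.PercolationContinuityZ3.Theses.PercDiodeSteering (UniformSteering RDMonotone)

/-! ## Objects of the line -/

/-- `θ⁺(p, r)`: the forward-percolation probability of the resistor–diode network on `ℤ³` at forward
threshold `p` and backward threshold `p·r` — VERBATIM the common `let θ` of every item of the route. -/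
def thetaRD (p r : ℝ) : ℝ :=
  (labelMeasure (Site 3)).real {U | {y : Site 3 | Relation.ReflTransGen
    (fun x z : Site 3 => (x ⋖ z ∧ U s(x, z) ≤ p) ∨ (z ⋖ x ∧ U s(x, z) ≤ p * r)) 0 y}.Infinite}

/-- `p_c(r) := inf {q | θ⁺(q, r) > 0}`: the directed-side critical point at ratio `r` (verbatim the
crux's `sInf`). -/
def pcRD (r : ℝ) : ℝ := sInf {q : ℝ | 0 < thetaRD q r}

/-- `p_c = p_c(ℤ³)` (bond), a real number in `[0, 1]` (`criticalProb_mem_Icc`). -/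
def pc3 : ℝ := criticalProb (zdGraph 3) (0 : Site 3)

theorem pc3_nonneg : 0 ≤ pc3 := (criticalProb_mem_Icc (zdGraph 3) (0 : Site 3)).1

theorem pc3_le_one : pc3 ≤ 1 := (criticalProb_mem_Icc (zdGraph 3) (0 : Site 3)).2

/-- The crux, literally, in the line's vocabulary. -/
theorem uniformSteering_iff :
    UniformSteering ↔
      ∀ ε > (0 : ℝ), ∃ δ > (0 : ℝ), ∃ r₀ < (1 : ℝ), ∀ r : ℝ, r₀ ≤ r → r < 1 → ∀ p : ℝ,
        pcRD r ≤ p → p ≤ pcRD r + δ → thetaRD p r ≤ thetaRD (pcRD r) r + ε :=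
  Iff.rfl

/-! ## The three stub statements -/

/-- STUB 1 statement: upper semicontinuity of `θ⁺` at the corner `(p_c, 1)` from the upper right. -/
def EndpointUSC : Prop :=
  ∀ ε > (0 : ℝ), ∃ δ > (0 : ℝ), ∃ r₀ < (1 : ℝ), ∀ r : ℝ, r₀ ≤ r → r ≤ 1 → ∀ p : ℝ,
    pc3 ≤ p → p ≤ pc3 + δ → thetaRD p r ≤ thetaRD pc3 1 + ε

/-- STUB 2 statement: the critical curve is squeezed into the corner, `p_c ≤ p_c(r) ≤ p_c / r`. -/
def CriticalCurveSqueeze : Prop :=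
  ∀ r : ℝ, 0 < r → r < 1 → pc3 ≤ pcRD r ∧ pcRD r ≤ pc3 / r

/-- STUB 3 statement: no drop of the critical density at the corner —
`liminf_{r ↑ 1} θ⁺(p_c(r), r) ≥ θ⁺(p_c, 1)`. -/
def EndpointNoDrop : Prop :=
  ∀ ε > (0 : ℝ), ∃ r₀ < (1 : ℝ), ∀ r : ℝ, r₀ ≤ r → r < 1 → thetaRD pc3 1 ≤ thetaRD (pcRD r) r + ε

/-! ## Registered stubs -/

/-- **STUB 1 `endpointUSC`** (M, TRUE): `θ⁺(p, r) ≤ θ⁺(p_c, 1) + ε` for `r ∈ [r₀, 1]`, `p ∈ [p_c, p_c + δ]`.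
Proof sketch: `θ⁺(p, r) ≤ θ⁺(min p 1, 1) = θ(min p 1)` by the identity coupling of labels (`RDMonotone`:
`p ≥ p_c ≥ 0`, `r ≤ 1`; labels are a.s. `≤ 1`) and `RDEndpoint`; then right-continuity of `θ` at `p_c`:
`θ(p) ≤ P_p(0 ↔ ∂B(n)) ≤ P_{p_c}(0 ↔ ∂B(n)) + ε/2 ≤ θ(p_c) + ε` for `n` large and `p − p_c` small
(`theta_le_real_siteToBoundary`, continuity of the box polynomial in `p`, `P_{p_c}(0 ↔ ∂B(n)) ↓ θ(p_c)`). -/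
theorem stub_endpointUSC : EndpointUSC := by
  sorry

/-- **STUB 2 `criticalCurveSqueeze`** (M, TRUE): `p_c ≤ p_c(r) ≤ p_c / r` for `0 < r < 1`.
Proof sketch: `S_r := {q | θ⁺(q, r) > 0}` contains every `q ≥ 1` (all forward labels pass a.s., the
positive orthant is forward-reachable) and every `q > p_c / r` with `q r ≤ 1` (`θ⁺(q, r) ≥ θ⁺(q r, 1) =
θ(q r) > 0` above `p_c`, `RDMonotone` + `RDEndpoint` + definition of `criticalProb`); and `q ∈ S_r ⇒
p_c ≤ q` (`θ⁺(q, r) ≤ θ⁺(max q 0 ⊓ 1, 1) = θ = 0` below `p_c`, `theta_eq_zero_of_lt_criticalProb_holds`,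
`theta_bot`), exactly as in the route's `closes`. Then `le_csInf` / `csInf_le` + `le_of_forall_gt`. -/
theorem stub_criticalCurveSqueeze : CriticalCurveSqueeze := by
  sorry

/-- **STUB 3 `endpointNoDrop`** (OPEN — LOAD-BEARING): `∀ ε > 0, ∃ r₀ < 1, ∀ r ∈ [r₀, 1),
θ⁺(p_c, 1) ≤ θ⁺(p_c(r), r) + ε`. The residue of the conjunct carried by this route, in liminf form:
implied by the crux (`endpointNoDrop_of_uniformSteering`), hence by `θ(p_c) = 0`; false in a jump world
where `BackboneSteering` and `DiodeEnhancement` hold. Why it might fail: it is refutable exactly by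
`θ(p_c) > 0`; barrier `Literature.Barriers.CriticalPhenomena.SlabLimitUniformControl` (uniform control of
an exhausting family of thresholds, here `r ↑ 1`) applies squarely; the route's own quantitative glue
(Margulis–Russo at block scale `L₀(r)`, needs `L₀(r)³ γ(r) → 0`, i.e. crossover exponent `φ > 3ν`) is
not expected to reach it. -/
theorem stub_endpointNoDrop : EndpointNoDrop := by
  sorry

/-! ### Name-keyed aliases of the stub statements
`__Registered.stub_X` is statement `X` under the registered stub's short name, so that the native skeleton
audit (`#h21_check_skeleton`: hypotheses admissible iff registered obligations / declared stubs BY NAME)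
accepts `UniformSteering_of : __Registered.stub_… → … → UniformSteering` (device of
`Cruxes/BGNOffTheFloor/Lines/birth.lean`; the `@[stub]` attribute is gate-reserved). -/
namespace __Registered

/-- Alias of `EndpointUSC` keyed by the registered stub name. -/
abbrev stub_endpointUSC : Prop := EndpointUSC
/-- Alias of `CriticalCurveSqueeze` keyed by the registered stub name. -/
abbrev stub_criticalCurveSqueeze : Prop := CriticalCurveSqueeze
/-- Alias of `EndpointNoDrop` keyed by the registered stub name. -/
abbrev stub_endpointNoDrop : Prop := EndpointNoDrop

end __Registered

/-! ## Proved plumbing -/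

/-- The corner gap: for `r ∈ [1 − η/4, 1)` with `r ≥ 1/2` one has `p_c / r ≤ p_c + η/2`
(`p_c (1 − r) / r ≤ 2 (1 − r)` as `0 ≤ p_c ≤ 1`). -/
theorem pc3_div_le {r η : ℝ} (hhalf : 1 / 2 ≤ r) (hr1 : r ≤ 1) (hrη : 1 - η / 4 ≤ r) :
    pc3 / r ≤ pc3 + η / 2 := by
  have hrpos : 0 < r := by linarith
  rw [div_le_iff₀ hrpos]
  have h1 : pc3 * (1 - r) ≤ 1 * (1 - r) := mul_le_mul_of_nonneg_right pc3_le_one (by linarith)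
  have h2 : η / 4 ≤ η / 2 * r := by nlinarith
  nlinarith [pc3_nonneg]

/-- STUB 3 is an HONEST PIECE: the crux implies it, given the identity coupling (`RDMonotone`, route
support item stmt-CriticalPhenomena-7552) and the lower half of STUB 2 — at `p = p_c(r) + δ` the
window bound reads `θ⁺(p_c(r) + δ, r) ≤ θ⁺(p_c(r), r) + ε`, and `θ⁺(p_c, 1) ≤ θ⁺(p_c(r) + δ, r)` as soon
as `p_c ≤ (p_c(r) + δ) r`, i.e. for `r` close to `1`. -/
theorem endpointNoDrop_of_uniformSteering (hM : RDMonotone) (hsq : CriticalCurveSqueeze)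
    (hU : UniformSteering) : EndpointNoDrop := by
  rw [uniformSteering_iff] at hU
  intro ε hε
  obtain ⟨δ, hδ, r₀, hr₀, H⟩ := hU ε hε
  refine ⟨max r₀ (max (1 / 2) (1 - δ / 2)), max_lt hr₀ (max_lt (by norm_num) (by linarith)), ?_⟩
  intro r hr hr1
  have hr₀r : r₀ ≤ r := (le_max_left _ _).trans hr
  have hhalf : 1 / 2 ≤ r := ((le_max_left _ _).trans (le_max_right _ _)).trans hr
  have hrδ : 1 - δ / 2 ≤ r := ((le_max_right _ _).trans (le_max_right _ _)).trans hr
  have hrpos : 0 < r := by linarith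
  obtain ⟨hlo, -⟩ := hsq r hrpos hr1
  -- the window bound at its right end `p = p_c(r) + δ`
  have hwin : thetaRD (pcRD r + δ) r ≤ thetaRD (pcRD r) r + ε :=
    H r hr₀r hr1 (pcRD r + δ) (by linarith) le_rfl
  -- the corner is dominated by that point: `p_c ≤ p_c(r) + δ` and `p_c · 1 ≤ (p_c(r) + δ) · r`
  have hdom : thetaRD pc3 1 ≤ thetaRD (pcRD r + δ) r := by
    have h1 : pc3 ≤ pcRD r + δ := by linarith
    have h2 : pc3 * 1 ≤ (pcRD r + δ) * r := by
      have : pc3 * (1 - r) ≤ 1 * (1 - r) := mul_le_mul_of_nonneg_right pc3_le_one (by linarith)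
      nlinarith [pc3_nonneg, hlo]
    exact hM pc3 (pcRD r + δ) 1 r h1 h2
  exact hdom.trans hwin

/-! ## The composition, by name -/

/-- **`UniformSteering_of`**: the three registered stubs imply the crux
`Summit.CriticalPhenomena.PercolationContinuityZ3.Theses.PercDiodeSteering.UniformSteering`
(kernel-checked; no `sorry` outside the stubs). -/
theorem UniformSteering_of (husc : __Registered.stub_endpointUSC)
    (hsq : __Registered.stub_criticalCurveSqueeze) (hdrop : __Registered.stub_endpointNoDrop) :
    Summit.CriticalPhenomena.PercolationContinuityZ3.Theses.PercDiodeSteering.UniformSteering := by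
  rw [uniformSteering_iff]
  intro ε hε
  obtain ⟨δ₁, hδ₁, r₁, hr₁, H1⟩ := husc (ε / 2) (half_pos hε)
  obtain ⟨r₂, hr₂, H3⟩ := hdrop (ε / 2) (half_pos hε)
  refine ⟨δ₁ / 2, half_pos hδ₁, max r₁ (max r₂ (max (1 / 2) (1 - δ₁ / 4))),
    max_lt hr₁ (max_lt hr₂ (max_lt (by norm_num) (by linarith))), ?_⟩
  intro r hr hr1 p hlo hhi
  have hr₁r : r₁ ≤ r := (le_max_left _ _).trans hr
  have hr₂r : r₂ ≤ r := ((le_max_left _ _).trans (le_max_right _ _)).trans hr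
  have hhalf : 1 / 2 ≤ r := ((le_max_left _ _).trans ((le_max_right _ _).trans (le_max_right _ _))).trans hr
  have hrδ : 1 - δ₁ / 4 ≤ r :=
    ((le_max_right _ _).trans ((le_max_right _ _).trans (le_max_right _ _))).trans hr
  have hrpos : 0 < r := by linarith
  obtain ⟨hsq₁, hsq₂⟩ := hsq r hrpos hr1
  -- the window `[p_c(r), p_c(r) + δ₁/2]` sits inside `[p_c, p_c + δ₁]`
  have hp₁ : pc3 ≤ p := hsq₁.trans hlo
  have hp₂ : p ≤ pc3 + δ₁ := by
    have hgap : pc3 / r ≤ pc3 + δ₁ / 2 := pc3_div_le hhalf hr1.le hrδ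
    linarith
  calc thetaRD p r ≤ thetaRD pc3 1 + ε / 2 := H1 r hr₁r hr1.le p hp₁ hp₂
    _ ≤ thetaRD (pcRD r) r + ε / 2 + ε / 2 := by linarith [H3 r hr₂r hr1]
    _ = thetaRD (pcRD r) r + ε := by ring

/-- Wiring check: the registered stubs feed `UniformSteering_of` as stated. -/
example : Summit.CriticalPhenomena.PercolationContinuityZ3.Theses.PercDiodeSteering.UniformSteering :=
  UniformSteering_of stub_endpointUSC stub_criticalCurveSqueeze stub_endpointNoDrop

end Summit.CriticalPhenomena.PercolationContinuityZ3.Cruxes.UniformSteering.Birth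

end
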